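import Literature.NumberTheory.EllipticCurves.IsogenyRamification
import Literature.NumberTheory.EllipticCurves.IsogenyPolarDegree
import Literature.NumberTheory.EllipticCurves.IsogenyDeterminantProofs
import HarnessLib

/-!
# `deg` is a quadratic form on `Hom_K(E, E')` (Silverman, *AEC*, Cor. III.6.3): discharge

Topic `NumberTheory/EllipticCurves` (trunk T-ELLARITH, notion `cm_endomorphisms_isogeny`). A
*proofs* file (D-0014: nothing is defined, all declarations are theorems) discharging the named
fact

* `WeierstrassCurve.degHom_isQuadraticForm W W'` of `Literature.NumberTheory.EllipticCurves.IsogenyDegree`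
  — Silverman, *The Arithmetic of Elliptic Curves*, 2nd ed., Cor. III.6.3 (PDF p. 81): the degree
  `deg : Hom(E₁, E₂) → ℤ` is a (positive definite) quadratic form, i.e. (i) `deg(-φ) = deg φ` and
  (ii) `⟨φ, ψ⟩ = deg(φ + ψ) - deg φ - deg ψ` is bilinear, here on `Hom_K(E, E')` (`homModule`) and
  for the real degree `degHom = [K̄(E) : φ^* K̄(E')]` —

as `WeierstrassCurve.degHom_isQuadraticForm_holds`, and recording the discharge downstream of it
that the tree had already reduced to Cor. III.6.3:

* `WeierstrassCurve.Isogeny.det_tateModule_map_eq_deg_holds` — Prop. III.8.6 (PDF p. 92),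
  `det(φ_ℓ) = deg φ` on `T_ℓ E` for `φ ∈ End_K(E)`, `ℓ ≠ char K`
  (`Isogeny.det_tateModule_map_eq_deg_of_isQuadraticForm` of `IsogenyDeterminantProofs`).

Through `trace_galoisRepTate_frobenius_of_det_tateModule_map_eq_deg` (`FrobeniusTateModuleProofs`)
this also gives Silverman's own proof of Thm. V.2.3.1 (`tr(φ_ℓ) = 1 + deg φ - deg(1 - φ)`); the
tree's discharge `trace_galoisRepTate_frobenius_holds` (`FrobeniusTateModuleTraceProofs`, by Manin's
relation `φ² - aφ + q = 0`) is independent of this file and is not restated.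

## The proof of Cor. III.6.3

Not Silverman's (which is `[⟨φ, ψ⟩] = φ̂ψ + ψ̂φ` through the dual isogeny, Thm. III.6.2). The
tree holds two degree functions on `Hom(E(K̄), E'(K̄))`:

* `degHom W W' f` (`IsogenyDegree`): `[K̄(E) : φ^* K̄(E')]` if `f` is the map of the isogeny `φ`,
  else `0`;
* `polarDegHom f` (`IsogenyPolarDegree`): the polar degree `d(φ(x, y)) = Σ_{φ(x,y)(P) = O'} e(P)`
  of the generic image `φ(x, y) ∈ E'(K̄(E))` read as an `L`-point (`LPointPolarDegree`), else `0`,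
  for which the **parallelogram law** `d(f + g) + d(f - g) = 2d(f) + 2d(g)` on `Hom_K(E, E')` is
  proved in the tree by counting poles (`polarDegHom_parallelogram`).

This file identifies them (`polarDegHom_eq_degHom`, the degree half of Prop. II.2.6(a), PDF p. 33):
the pull-back of the `L`-point `φ(x, y)` *is* `φ^*` (`Isogeny.pointPullback_genericLPoint`, by
`rfl`), so its ramification indices are the `e_φ(P)` of `IsogenyRamification` wherever `φ(x, y)`
specialises to `φ P` (`Isogeny.ramificationIdx_genericLPoint_eq`); the polar degree is the degree
`D(Q)` of any fibre (`fibreDegree_eq_fibreDegree_zero`), and over `Q = φ P₀` for a generic `P₀`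
the fibre of `φ(x, y)` is `φ⁻¹(Q)`, so `d(φ(x, y)) = Σ_{P ∈ φ⁻¹(Q)} e_φ(P) = deg φ` by
Prop. II.2.6(a) for isogenies (`Isogeny.sum_ramificationIndex_eq_deg` of `IsogenyRamification`)
— `Isogeny.polarDegHom_toAddMonoidHom`. Hence the parallelogram law for `degHom`
(`parallelogram_degHom`), and the Jordan–von Neumann argument over `ℤ` (inlined in
`degHom_isQuadraticForm_holds`: `B(x + y, z) + B(x - y, z) = 2B(x, z)`, so
`2B(f + g, h) = B(2f, h) + B(2g, h) = 2B(f, h) + 2B(g, h)`; cf. the tree's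
`Literature.AlgebraicGeometry.Motives.polar_add_left_of_parallelogram` in `FaltingsECProofs`, not imported here to keep this file
below the motives files) gives (ii); (i) is the law at `(0, f)`.

## References

* [SilvermanAEC2009] J. H. Silverman, *The Arithmetic of Elliptic Curves*, 2nd ed., GTM 106,
  Springer 2009: II.§2 (`e_φ(P)`; Prop. II.2.6(a), PDF p. 33), III.§6 (Definition of a quadratic
  form and Cor. III.6.3, PDF p. 81), Prop. III.8.6 (PDF p. 92), Thm. V.2.3.1 (PDF p. 129).
* P. Jordan, J. von Neumann, *On inner products in linear, metric spaces*, Ann. of Math. (2) 36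
  (1935), 719–723 (the parallelogram law characterises quadratic forms). [folklore]

## Design

`noncomputable section`, `open scoped Classical`, one universe `u`, dot-notation extensions in
`namespace WeierstrassCurve(.Isogeny)` as in the sibling files; imports `IsogenyRamification`
(II.2.6(a) for isogenies), `IsogenyPolarDegree` (the polar degree and its parallelogram law) and
`IsogenyDeterminantProofs` (III.8.6 from III.6.3). The `_holds` theorems take the curves
explicitly and no instance arguments, matching the `∀ [W.IsElliptic] …` shape of the facts.
-/

noncomputable section

open scoped Classical

universe u

namespace WeierstrassCurve

open Literature.NumberTheory.EllipticCurves.WeierstrassFunctionField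

variable {K : Type u} [Field K] {W W' : WeierstrassCurve K}

/-! ## The polar degree of an isogeny is its degree (Silverman, *AEC*, Prop. II.2.6(a)) -/

namespace Isogeny

variable [W.IsElliptic] [W'.IsElliptic] (φ : Isogeny W W')

/-- The pull-back of function fields along the generic image `φ(x, y) ∈ E'(K̄(E))`, read as an
`L`-point (`FunctionFieldLPoints.pointPullback`), is `φ^* : K̄(E') → K̄(E)`
(`Isogeny.pullbackHom`): both are the extension to fraction fields of `x' ↦ φ^* x'`,
`y' ↦ φ^* y'`. [folklore] -/
theorem pointPullback_genericLPoint :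
    pointPullback (V := (W.baseChange (AlgebraicClosure K)).toAffine)
      (V' := (W'.baseChange (AlgebraicClosure K)).toAffine)
      φ.nonsingular_pullback'.left φ.transcendental_pullbackX = φ.pullbackHom := rfl

/-- **The two ramification indices agree.** At a point `P` where the generic image `φ(x, y)`
specialises to `φ P` (all but finitely many `P`, `specialize_genericLPoint`), the ramification
index `e_{φ(x,y)}(P)` of the `L`-point (`FunctionFieldLPoints.ramificationIdx`, defined by
`v_P ∘ φ(x,y)^* = v_{φ(x,y)(P)}^e`) is the ramification index `e_φ(P)` of the isogeny
(`Isogeny.ramificationIndex`, defined by `v_P ∘ φ^* = v_{φ P}^e`). Silverman, *AEC*, II.§2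
(definition of `e_φ(P)`). [folklore] -/
theorem ramificationIdx_genericLPoint_eq {P : W.geomPoints}
    (hP : specialize (W.baseChange (AlgebraicClosure K)).toAffine
      (W'.baseChange (AlgebraicClosure K)).toAffine P φ.genericLPoint = φ P) :
    ramificationIdx (W.baseChange (AlgebraicClosure K)).toAffine
      (W'.baseChange (AlgebraicClosure K)).toAffine P φ.nonsingular_pullback'
      φ.transcendental_pullbackX = φ.ramificationIndex P := by
  refine (φ.ramificationIndex_eq_of_forall fun u ↦ ?_).symm
  have hP' : specialize (W.baseChange (AlgebraicClosure K)).toAffine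
      (W'.baseChange (AlgebraicClosure K)).toAffine P
      (.some φ.pullbackX φ.pullbackY φ.nonsingular_pullback') = φ P := hP
  have h := placeValuation_pointPullback (V := (W.baseChange (AlgebraicClosure K)).toAffine)
    (V' := (W'.baseChange (AlgebraicClosure K)).toAffine) P φ.nonsingular_pullback'
    φ.transcendental_pullbackX u
  rw [hP', pointPullback_genericLPoint] at h
  exact h

/-- **The polar degree of (the map underlying) an isogeny is its degree**:
`d(φ(x, y)) = Σ_{P ∈ φ⁻¹(Q)} e_φ(P) = deg φ = [K̄(E) : φ^* K̄(E')]`. The polar degree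
(`polarDegHom`, `IsogenyPolarDegree`) is the fibre degree `D_{φ(x,y)}(Q)` of the generic image over
any `Q` (`fibreDegree_eq_fibreDegree_zero`); for `Q = φ P₀` with `P₀` generic (every point of
`φ⁻¹(φ P₀) = P₀ + ker φ` a point of agreement of the rational representation, and no exceptional
point specialising to `φ P₀`) the fibre of `φ(x, y)` over `Q` is `φ⁻¹(Q)` with the ramification
indices `e_φ(P)` (`ramificationIdx_genericLPoint_eq`), whose sum is `deg φ` by Prop. II.2.6(a)
(`Isogeny.sum_ramificationIndex_eq_deg`, `IsogenyRamification`).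
[cite: SilvermanAEC2009, Prop. II.2.6(a)] -/
theorem polarDegHom_toAddMonoidHom : polarDegHom φ.toAddMonoidHom = φ.deg := by
  classical
  set V := (W.baseChange (AlgebraicClosure K)).toAffine with hV
  set V' := (W'.baseChange (AlgebraicClosure K)).toAffine with hV'
  -- the exceptional set and the kernel
  set Bset : Set W.geomPoints := {P | ¬ AgreesWithRationalMapAt W W' φ.rationalRep.P₁
    φ.rationalRep.Q₁ φ.rationalRep.P₂ φ.rationalRep.Q₂ φ P} with hBset
  have hB : Bset.Finite := φ.rationalRep.finite
  have hBiff : ∀ {P}, P ∉ Bset ↔ AgreesWithRationalMapAt W W' φ.rationalRep.P₁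
      φ.rationalRep.Q₁ φ.rationalRep.P₂ φ.rationalRep.Q₂ φ P := fun {P} ↦ by
    rw [hBset, Set.mem_setOf_eq, not_not]
  set kerS : Set W.geomPoints := (φ.toAddMonoidHom.ker : Set W.geomPoints) with hkerS
  have hK : kerS.Finite := φ.finite_ker
  have hmemK : ∀ {T}, T ∈ kerS ↔ φ T = 0 := fun {T} ↦ by
    rw [hkerS, SetLike.mem_coe, AddMonoidHom.mem_ker, Isogeny.coe_toAddMonoidHom]
  -- the bad set for `P₀`
  set bad₁ : Set W.geomPoints := ⋃ T ∈ kerS, (fun Q ↦ Q - T) '' Bset with hbad₁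
  have f₁ : bad₁.Finite := hK.biUnion fun T _ ↦ hB.image _
  set S₁ : Set W'.geomPoints := (fun P ↦ specialize V V' P φ.genericLPoint) '' Bset with hS₁
  set bad₂ : Set W.geomPoints := ⋃ Q ∈ S₁, {P | φ P = Q} with hbad₂
  have f₂ : bad₂.Finite := (hB.image _).biUnion fun Q _ ↦ φ.finite_fibre Q
  haveI : Infinite W.geomPoints := WeierstrassCurve.infinite_point (V := W.baseChange _)
  obtain ⟨P₀, hP₀⟩ := (f₁.union f₂).infinite_compl.nonempty
  rw [Set.mem_compl_iff, Set.mem_union, not_or] at hP₀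
  obtain ⟨n₁, n₂⟩ := hP₀
  -- unpacking the conditions
  have c₁ : ∀ P, φ P = φ P₀ → P ∉ Bset := by
    intro P hP hmem
    refine n₁ (Set.mem_biUnion (x := P - P₀) (hmemK.mpr ?_) ⟨P, hmem, sub_sub_cancel P P₀⟩)
    rw [map_sub, hP, sub_self]
  have c₂ : ∀ P ∈ Bset, specialize V V' P φ.genericLPoint ≠ φ P₀ := fun P hP heq ↦
    n₂ (Set.mem_biUnion ⟨P, hP, heq⟩ rfl)
  -- the fibre of `φ(x, y)` over `φ P₀` is `φ⁻¹(φ P₀)`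
  have hfib : ∀ P : W.geomPoints, specialize V V' P φ.genericLPoint = φ P₀ ↔ φ P = φ P₀ := by
    intro P
    constructor
    · intro hP
      have hPB : P ∉ Bset := fun h ↦ c₂ P h hP
      rwa [φ.specialize_genericLPoint (hBiff.mp hPB)] at hP
    · intro hP
      rw [φ.specialize_genericLPoint (hBiff.mp (c₁ P hP)), hP]
  -- `d = D(φ P₀) = Σ_{P ∈ φ⁻¹(φ P₀)} e_φ(P) = deg φ`
  have hdeg : polarDegHom φ.toAddMonoidHom = (fibreDegree V V' φ.nonsingular_pullback'
      φ.transcendental_pullbackX (φ P₀) : ℤ) := by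
    unfold polarDegHom
    rw [homLPoint_toAddMonoidHom, Isogeny.genericLPoint_eq,
      polarDeg_some_of_transcendental _ φ.transcendental_pullbackX,
      fibreDegree_eq_fibreDegree_zero _ _ (φ P₀)]
  rw [hdeg, Nat.cast_inj, fibreDegree_eq_sum, ← φ.sum_ramificationIndex_eq_deg (φ P₀)]
  have memA : ∀ P : W.geomPoints, P ∈ (finite_fibre_specialize (V := V) (V' := V')
      φ.nonsingular_pullback' φ.transcendental_pullbackX (φ P₀)).toFinset ↔
        specialize V V' P φ.genericLPoint = φ P₀ := fun P ↦
    Set.Finite.mem_toFinset _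
  have memB : ∀ P : W.geomPoints, P ∈ (φ.finite_fibre (φ P₀)).toFinset ↔ φ P = φ P₀ := fun P ↦
    Set.Finite.mem_toFinset _
  have hS : (finite_fibre_specialize (V := V) (V' := V') φ.nonsingular_pullback'
      φ.transcendental_pullbackX (φ P₀)).toFinset = (φ.finite_fibre (φ P₀)).toFinset :=
    Finset.ext fun P ↦ (memA P).trans ((hfib P).trans (memB P).symm)
  rw [hS]
  refine Finset.sum_congr rfl fun P hP ↦ ?_
  have hP' : φ P = φ P₀ := (memB P).mp hP
  exact φ.ramificationIdx_genericLPoint_eq (((hfib P).mpr hP').trans hP'.symm)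

end Isogeny

/-! ## `polarDegHom = degHom`; the parallelogram law for `degHom` -/

section DegHom

variable [W.IsElliptic] [W'.IsElliptic]

/-- **The polar degree is the degree**: on `Hom(E(K̄), E'(K̄))` the polar degree `polarDegHom`
of `IsogenyPolarDegree` (`d(f(x, y))`, and `0` off the isogenies) coincides with `degHom` of
`IsogenyDegree` (`[K̄(E) : φ^* K̄(E')]` on the map of an isogeny `φ`, and `0` off the isogenies).
Silverman, *AEC*, Prop. II.2.6(a). [cite: SilvermanAEC2009, Prop. II.2.6(a)] -/
theorem polarDegHom_eq_degHom (f : W.geomPoints →+ W'.geomPoints) :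
    polarDegHom f = degHom W W' f := by
  by_cases h : ∃ φ : Isogeny W W', φ.toAddMonoidHom = f
  · obtain ⟨φ, rfl⟩ := h
    rw [φ.polarDegHom_toAddMonoidHom, degHom_toAddMonoidHom]
  · rw [degHom_of_not_exists h]
    unfold polarDegHom
    rw [homLPoint, dif_neg h, polarDeg_zero, Nat.cast_zero]

/-- **The parallelogram law for the degree on `Hom_K(E, E')`**:
`deg(f + g) + deg(f - g) = 2 deg f + 2 deg g` (Silverman, *AEC*, Cor. III.6.3, in the form proved
by pole counting in `LPointPolarDegree.polarDeg_parallelogram` / `polarDegHom_parallelogram`),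
now for `degHom = [K̄(E) : φ^* K̄(E')]`. [cite: SilvermanAEC2009, Cor. III.6.3] -/
theorem parallelogram_degHom {f g : W.geomPoints →+ W'.geomPoints} (hf : f ∈ homModule W W')
    (hg : g ∈ homModule W W') :
    degHom W W' (f + g) + degHom W W' (f - g) = 2 * degHom W W' f + 2 * degHom W W' g := by
  simpa only [polarDegHom_eq_degHom] using polarDegHom_parallelogram hf hg

end DegHom

/-! ## Silverman, *AEC*, Cor. III.6.3: discharge of `degHom_isQuadraticForm` -/

/-- **Discharge of the named fact `degHom_isQuadraticForm W W'`** (Silverman, *AEC*,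
Cor. III.6.3: the degree map `deg : Hom(E₁, E₂) → ℤ` is a positive definite quadratic form, here
its parts (i) `deg(-φ) = deg φ` and (ii) bilinearity of `⟨φ, ψ⟩ = deg(φ + ψ) - deg φ - deg ψ` on
`Hom_K(E, E')`, over the real degree `degHom = [K̄(E) : φ^* K̄(E')]` of `IsogenyDegree`). The
printed proof goes through the dual isogeny (Thm. III.6.2); this one goes through the
parallelogram law for the polar degree (`LPointPolarDegree`, `IsogenyPolarDegree`: counting
poles of `x(φ(x, y)) - x(ψ(x, y))`), the identification of the polar degree with the degree
(`polarDegHom_eq_degHom`, Prop. II.2.6(a) via `IsogenyRamification`) and the Jordan–von Neumann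
argument over `ℤ` (inlined). [cite: SilvermanAEC2009, Cor. III.6.3] -/
theorem degHom_isQuadraticForm_holds (W W' : WeierstrassCurve K) : degHom_isQuadraticForm W W' := by
  intro _ _
  -- abbreviations: `Q = deg`, `S = Hom_K(E, E')`, the parallelogram law on `S`
  set Q : (W.geomPoints →+ W'.geomPoints) → ℤ := degHom W W' with hQ
  have h0 : Q 0 = 0 := degHom_zero
  have hpar : ∀ u ∈ homModule W W', ∀ v ∈ homModule W W',
      Q (u + v) + Q (u - v) = 2 * Q u + 2 * Q v := fun u hu v hv ↦ parallelogram_degHom hu hv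
  refine ⟨fun f hf ↦ ?_, fun f hf g hg h hh ↦ ?_⟩
  · -- (i) evenness: the law at `(0, f)`
    have h := hpar 0 (Submodule.zero_mem _) f hf
    rw [zero_add, zero_sub, h0] at h
    linarith
  · -- (ii) Jordan–von Neumann over `ℤ`: `B(x + y, z) + B(x - y, z) = 2B(x, z)` (two instances of
    -- the law), hence `B(2x, z) = 2B(x, z)`, and at `(x, y) = (f + g, f - g)`:
    -- `2B(f + g, h) = B(2f, h) + B(2g, h) = 2B(f, h) + 2B(g, h)`.
    have star : ∀ x ∈ homModule W W', ∀ y ∈ homModule W W', ∀ z ∈ homModule W W',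
        (Q (x + y + z) - Q (x + y) - Q z) + (Q (x - y + z) - Q (x - y) - Q z) =
          2 * (Q (x + z) - Q x - Q z) := by
      intro x hx y hy z hz
      have h1 := hpar (x + z) (Submodule.add_mem _ hx hz) y hy
      have h2 := hpar x hx y hy
      rw [show x + z + y = x + y + z by abel, show x + z - y = x - y + z by abel] at h1
      linarith
    have double : ∀ x ∈ homModule W W', ∀ z ∈ homModule W W',
        Q (x + x + z) - Q (x + x) - Q z = 2 * (Q (x + z) - Q x - Q z) := by
      intro x hx z hz
      have h := star x hx x hx z hz
      rw [sub_self, zero_add, h0] at h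
      linarith
    have h3 := star (f + g) (Submodule.add_mem _ hf hg) (f - g) (Submodule.sub_mem _ hf hg) h hh
    rw [show f + g + (f - g) = f + f by abel, show f + g - (f - g) = g + g by abel] at h3
    have h4 := double f hf h hh
    have h5 := double g hg h hh
    change Q (f + g + h) - Q (f + g) - Q h = (Q (f + h) - Q f - Q h) + (Q (g + h) - Q g - Q h)
    linarith

/-! ## Consequence: Prop. III.8.6 unconditionally -/

/-- **Discharge of the named fact `Isogeny.det_tateModule_map_eq_deg W ℓ`** (Silverman, *AEC*,
Prop. III.8.6: `det(φ_ℓ) = deg φ` on `T_ℓ E` for `φ ∈ End_K(E)` and a prime `ℓ ≠ char K`):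
`Isogeny.det_tateModule_map_eq_deg_of_isQuadraticForm` (`IsogenyDeterminantProofs`, III.8.6 from
Cor. III.6.3) with Cor. III.6.3 now proved (`degHom_isQuadraticForm_holds`).
[cite: SilvermanAEC2009, Prop. III.8.6] -/
theorem Isogeny.det_tateModule_map_eq_deg_holds (W : WeierstrassCurve K) (ℓ : ℕ) [Fact ℓ.Prime] :
    Isogeny.det_tateModule_map_eq_deg W ℓ :=
  Isogeny.det_tateModule_map_eq_deg_of_isQuadraticForm (degHom_isQuadraticForm_holds W W)

end WeierstrassCurve
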